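import Mathlib.InformationTheory.Hamming
import Mathlib.Data.ZMod.Basic
import Literature.InformationTheory.QuantumCodes.CSS
import Literature.InformationTheory.QuantumCodes.EvenWeightLogicals
import Literature.InformationTheory.QuantumCodes.AbelianTwoBlockCodes
import Literature.InformationTheory.QuantumCodes.BivariateBicycleCodes
import Literature.InformationTheory.QuantumCodes.TwoBlockOrbitReduction
import Literature.InformationTheory.QuantumCodes.BBPinnedDistanceFlat
import HarnessLib

/-!
# Even distance of two-block and bivariate-bicycle codes with odd block weights; parity certificates

Instances of the parity lemma of `EvenWeightLogicals.lean` ([MacWilliamsSloane1977, Ch. 1 §8 Problems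
(32), (34)]: `𝟙 ∈ rs H ⟹` every kernel vector of `H` has even weight).  For an abelian two-block code
`H^X = [A|B]`, `H^Z = [Bᵀ|Aᵀ]`, `A = circ(a)`, `B = circ(b)` over a finite abelian group `G`, every column
of `H^X` is a translate of `a` or of `b` and every column of `H^Z` a row of `B` or of `A`; so when
`|supp a|` and `|supp b|` are ODD the sum of all rows of `H^X` (of `H^Z`) is `𝟙`
(`AbelianTwoBlock.allOnes_vecMul_HX/HZ`) and every `Z`- or `X`-logical candidate has even weight.  For a
bivariate-bicycle code `QC(A, B)` [BravyiEtAl2024, §4: "A and B have exactly three non-zero entries in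
each row and each column … each qubit participates in six checks (three X-type plus three Z-type
checks)"] the printed weight-3 side condition `IsBBPoly` gives odd weight
(`BB.hammingNorm_eq_three_of_isBBPoly`), hence

* `BB.Code.even_hammingNorm_of_HX_mulVec_eq_zero` / `…_HZ_…` — every `Z`- (`X`-) logical has even weight;
* `BB.Code.even_d`, `BB.Code.even_d_of_isBBPoly` — the distance is even; `BB.even_d_instances` — so for
  the five printed codes `[[72,12,6]]`, …, `[[288,12,18]]` (whatever the value of `d`);
* certificate forms: `BB.Code.le_dZ_of_even` (a lower bound `d − 1 ≤ d^Z` with `d` even lifts to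
  `d ≤ d^Z`: kernels may stop at `wmax = d − 2`), `BB.Code.d_eq_of_witness_of_odd`, and — combined with
  the translation-orbit pin of `TwoBlockOrbitReduction.lean` — `BB.Code.d_eq_of_witness_of_not_exists_pinned_of_odd`
  ("no PINNED `Z`-logical of weight `≤ d − 2`" + a weight-`d` witness ⇒ `C.d = d`), its `IsBBPoly`
  wrapper, and the flat-index form `BB.Code.d_eq_of_pinned_witness_flat_of_odd` for checkers on
  `Fin (ℓm + ℓm)` bitmask rows — the shape of a `[[288,12,18]]` certificate with `wmax = 16`.

Everything is PROVED; no definitions, no named facts.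

## References
* [BravyiEtAl2024] S. Bravyi, A. W. Cross, J. M. Gambetta, D. Maslov, P. Rall, T. J. Yoder,
  *High-threshold and low-overhead fault-tolerant quantum memory*, Nature 627 (2024) 778–782 =
  arXiv:2308.07915, §4 (held text chunk p0009 L20–23: "A = A₁ + A₂ + A₃ … we also assume the Aᵢ are
  distinct … A and B have exactly three non-zero entries in each row and each column"; L53–54: "each
  qubit participates in six checks (three X-type plus three Z-type checks)"); Lemma 1 (chunk p0009
  L74–77: `d = d^Z = d^X`); SI §9.2 (chunk p0021 L60 – p0022 L12: translations are automorphisms).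
* [MacWilliamsSloane1977] F. J. MacWilliams, N. J. A. Sloane, *The Theory of Error-Correcting Codes*
  (North-Holland 1977), Ch. 1 §8 Problems (32), (34) (chunk p0032 L13, L25): `𝟙 · v = 0 ⟺ wt(v)` even.

## Mathlib / tree search (2026-08-26)
Mathlib: `Matrix.circulant_apply`, `Matrix.fromCols_apply_inl/inr`, `Equiv.subRight/subLeft/neg`,
`Fintype.sum_equiv`, `ZMod.natCast_eq_one_iff_odd`.  Tree (reused, nothing redefined):
`even_hammingNorm_of_mulVec_eq_zero`, `natCast_hammingNorm_eq_sum`, `CSSCode.even_dZ_of_allOnes_mem_rowSpX`,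
`CSSCode.le_dZ_of_even`, `CSSCode.dZ_eq_of_witness_of_even` (`EvenWeightLogicals.lean`);
`AbelianTwoBlock.HX/HZ/HX_def/HZ_def` (`AbelianTwoBlockCodes.lean`); `BB.Code`, `IsBBPoly`, `monomial`,
`coeffVec`, `d_eq_dZ`, `bb72 … bb288`, `isBBPoly_bb72 …`, `BB.hammingNorm_comp_equiv`
(`BivariateBicycleCodes.lean`); `BB.Code.le_dZ_of_pinned` (`TwoBlockOrbitReduction.lean`);
`HXFlat_mulVec_eq_zero_iff`, `mem_rowSpace_HZFlat_iff`, `forall_inl_eq_zero_iff`, `qubitIndex`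
(`BBPinnedDistanceFlat.lean` / `BivariateBicycleCodes.lean`).  No tree declaration states evenness of a
BB / two-block distance (`lean search "Even .*\\.d\b|even_d"` in `InformationTheory`: none).
-/

namespace Literature.InformationTheory.QuantumCodes

open Matrix

/-! ### Abelian two-block codes: column weights of `[A|B]` and `[Bᵀ|Aᵀ]` -/

namespace AbelianTwoBlock

variable {G : Type*} [Fintype G] [AddCommGroup G]

/-- Every column of a circulant `circ(v)` is a translate of `v`: `Σᵢ circ(v) i j = Σ_g v g`.
[cite: BravyiEtAl2024, §4 (arXiv:2308.07915 chunk p0009 L23: "A and B have exactly three non-zero entries in each row and each column")] -/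
theorem sum_circulant_col {α : Type*} [AddCommMonoid α] (v : G → α) (j : G) :
    ∑ i, circulant v i j = ∑ g, v g := by
  simp only [circulant_apply]
  exact Fintype.sum_equiv (Equiv.subRight j) _ _ fun _ => rfl

/-- Every row of a circulant `circ(v)` is a reflected translate of `v`: `Σⱼ circ(v) i j = Σ_g v g`.
[cite: BravyiEtAl2024, §4 (arXiv:2308.07915 chunk p0009 L23)] -/
theorem sum_circulant_row {α : Type*} [AddCommMonoid α] (v : G → α) (i : G) :
    ∑ j, circulant v i j = ∑ g, v g := by
  simp only [circulant_apply]
  exact Fintype.sum_equiv (Equiv.subLeft i) _ _ fun _ => rfl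

omit [AddCommGroup G] in
/-- The weight of `v : G → 𝔽₂` mod 2 is `Σ_g v g`; odd weight means `Σ_g v g = 1`.
[cite: MacWilliamsSloane1977, Ch. 1 §8 Problem (32) (chunk p0032 L13)] -/
theorem sum_eq_one_of_odd {v : G → ZMod 2} (hv : Odd (hammingNorm v)) : ∑ g, v g = 1 := by
  rw [← natCast_hammingNorm_eq_sum, ZMod.natCast_eq_one_iff_odd]
  exact hv

/-- **The sum of all rows of `H^X = [A|B]` is `𝟙`** when `|supp a|` and `|supp b|` are odd (every column
of `A = circ(a)`, resp. `B = circ(b)`, is a translate of `a`, resp. `b`).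
[cite: BravyiEtAl2024, §4 (arXiv:2308.07915 chunk p0009 L23, L53–54: "each qubit participates in six checks (three X-type plus three Z-type checks)")] -/
theorem allOnes_vecMul_HX {a b : G → ZMod 2} (ha : Odd (hammingNorm a)) (hb : Odd (hammingNorm b)) :
    (fun _ => (1 : ZMod 2)) ᵥ* HX a b = fun _ => 1 := by
  funext q
  rcases q with g | g
  · simp only [vecMul, dotProduct, one_mul, HX_def, fromCols_apply_inl]
    rw [sum_circulant_col, sum_eq_one_of_odd ha]
  · simp only [vecMul, dotProduct, one_mul, HX_def, fromCols_apply_inr]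
    rw [sum_circulant_col, sum_eq_one_of_odd hb]

/-- **The sum of all rows of `H^Z = [Bᵀ|Aᵀ]` is `𝟙`** when `|supp a|`, `|supp b|` are odd (columns of
`Bᵀ`, `Aᵀ` are rows of `B`, `A`). [cite: BravyiEtAl2024, §4 (arXiv:2308.07915 chunk p0009 L23, L53–54)] -/
theorem allOnes_vecMul_HZ {a b : G → ZMod 2} (ha : Odd (hammingNorm a)) (hb : Odd (hammingNorm b)) :
    (fun _ => (1 : ZMod 2)) ᵥ* HZ a b = fun _ => 1 := by
  funext q
  rcases q with g | g
  · simp only [vecMul, dotProduct, one_mul, HZ_def, fromCols_apply_inl, transpose_apply]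
    rw [sum_circulant_row, sum_eq_one_of_odd hb]
  · simp only [vecMul, dotProduct, one_mul, HZ_def, fromCols_apply_inr, transpose_apply]
    rw [sum_circulant_row, sum_eq_one_of_odd ha]

/-- `𝟙 ∈ rs H^X` for odd block weights. [cite: BravyiEtAl2024, §4 (arXiv:2308.07915 chunk p0009 L23, L53–54)] -/
theorem allOnes_mem_rowSpace_HX {a b : G → ZMod 2} (ha : Odd (hammingNorm a))
    (hb : Odd (hammingNorm b)) : (fun _ => (1 : ZMod 2)) ∈ rowSpace (HX a b) :=
  mem_rowSpace_of_vecMul_eq _ (allOnes_vecMul_HX ha hb)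

/-- `𝟙 ∈ rs H^Z` for odd block weights. [cite: BravyiEtAl2024, §4 (arXiv:2308.07915 chunk p0009 L23, L53–54)] -/
theorem allOnes_mem_rowSpace_HZ {a b : G → ZMod 2} (ha : Odd (hammingNorm a))
    (hb : Odd (hammingNorm b)) : (fun _ => (1 : ZMod 2)) ∈ rowSpace (HZ a b) :=
  mem_rowSpace_of_vecMul_eq _ (allOnes_vecMul_HZ ha hb)

/-- **Even `Z`-logicals**: for odd block weights every `v` with `H^X v = 0` has even weight.
[cite: MacWilliamsSloane1977, Ch. 1 §8 Problems (32), (34) (chunk p0032 L13, L25)] [cite: BravyiEtAl2024, §4 (arXiv:2308.07915 chunk p0009 L23, L53–54)] -/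
theorem even_hammingNorm_of_HX_mulVec_eq_zero {a b : G → ZMod 2} (ha : Odd (hammingNorm a))
    (hb : Odd (hammingNorm b)) {v : G ⊕ G → ZMod 2} (hv : HX a b *ᵥ v = 0) : Even (hammingNorm v) :=
  even_hammingNorm_of_mulVec_eq_zero (allOnes_mem_rowSpace_HX ha hb) hv

/-- **Even `X`-logicals**: for odd block weights every `v` with `H^Z v = 0` has even weight.
[cite: MacWilliamsSloane1977, Ch. 1 §8 Problems (32), (34) (chunk p0032 L13, L25)] [cite: BravyiEtAl2024, §4 (arXiv:2308.07915 chunk p0009 L23, L53–54)] -/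
theorem even_hammingNorm_of_HZ_mulVec_eq_zero {a b : G → ZMod 2} (ha : Odd (hammingNorm a))
    (hb : Odd (hammingNorm b)) {v : G ⊕ G → ZMod 2} (hv : HZ a b *ᵥ v = 0) : Even (hammingNorm v) :=
  even_hammingNorm_of_mulVec_eq_zero (allOnes_mem_rowSpace_HZ ha hb) hv

end AbelianTwoBlock

/-! ### Bivariate-bicycle codes `QC(A, B)`: weight-3 polynomials, even distance, certificates -/

namespace BB

variable {ℓ m : ℕ}

/-- The coefficient vector `g ↦ p(−g)` has the weight of `p`. [cite: BravyiEtAl2024, §4 (arXiv:2308.07915 chunk p0009 L23)] -/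
theorem hammingNorm_coeffVec (p : Poly ℓ m) : hammingNorm (coeffVec p) = hammingNorm p := by
  have h : coeffVec p = p ∘ (Equiv.neg (Mono ℓ m)).symm := by
    funext g; simp [coeffVec]
  rw [h]
  exact hammingNorm_comp_equiv p (Equiv.neg (Mono ℓ m))

/-- **A BB polynomial has weight 3**: three pairwise distinct monomials have exactly three nonzero
coefficients ("A and B have exactly three non-zero entries in each row and each column").
[cite: BravyiEtAl2024, §4 (arXiv:2308.07915 chunk p0009 L20–23)] -/
theorem hammingNorm_eq_three_of_isBBPoly [NeZero ℓ] [NeZero m] {p : Poly ℓ m} (hp : IsBBPoly p) :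
    hammingNorm p = 3 := by
  classical
  obtain ⟨g₁, g₂, g₃, h12, h13, h23, -, rfl⟩ := hp
  have hval : ∀ g : Mono ℓ m,
      (monomial g₁.1 g₁.2 + monomial g₂.1 g₂.2 + monomial g₃.1 g₃.2 : Poly ℓ m) g ≠ 0 ↔
        g = g₁ ∨ g = g₂ ∨ g = g₃ := by
    intro g
    simp only [monomial, Prod.mk.eta, Pi.add_apply, Pi.single_apply]
    by_cases e1 : g = g₁
    · subst e1; simp [h12, h13]
    · by_cases e2 : g = g₂
      · subst e2; simp [e1, h23]
      · by_cases e3 : g = g₃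
        · subst e3; simp [e1, e2]
        · simp [e1, e2, e3]
  unfold hammingNorm
  rw [show (Finset.univ.filter fun g => (monomial g₁.1 g₁.2 + monomial g₂.1 g₂.2 +
      monomial g₃.1 g₃.2 : Poly ℓ m) g ≠ 0) = {g₁, g₂, g₃} from ?_]
  · rw [Finset.card_insert_of_notMem (by simp [h12, h13]), Finset.card_insert_of_notMem (by simp [h23]),
      Finset.card_singleton]
  · ext g
    simp only [Finset.mem_filter, Finset.mem_univ, true_and, Finset.mem_insert, Finset.mem_singleton]
    exact hval g

/-- The weight-3 side condition gives odd weight. [cite: BravyiEtAl2024, §4 (arXiv:2308.07915 chunk p0009 L20–23)] -/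
theorem odd_hammingNorm_of_isBBPoly [NeZero ℓ] [NeZero m] {p : Poly ℓ m} (hp : IsBBPoly p) :
    Odd (hammingNorm p) := by
  rw [hammingNorm_eq_three_of_isBBPoly hp]
  exact ⟨1, rfl⟩

namespace Code

variable [NeZero ℓ] [NeZero m] (C : Code ℓ m)

/-- **Each qubit of `QC(A, B)` meets an odd number of `X`-checks**: for odd `|A|`, `|B|` the sum of all
rows of `H^X = [A|B]` is `𝟙`. [cite: BravyiEtAl2024, §4 (arXiv:2308.07915 chunk p0009 L23, L53–54: "each qubit participates in six checks (three X-type plus three Z-type checks)")] -/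
theorem allOnes_vecMul_HX (hA : Odd (hammingNorm C.A)) (hB : Odd (hammingNorm C.B)) :
    (fun _ => (1 : ZMod 2)) ᵥ* C.HX = fun _ => 1 :=
  AbelianTwoBlock.allOnes_vecMul_HX (by rwa [hammingNorm_coeffVec]) (by rwa [hammingNorm_coeffVec])

/-- … and an odd number of `Z`-checks: the sum of all rows of `H^Z = [Bᵀ|Aᵀ]` is `𝟙`.
[cite: BravyiEtAl2024, §4 (arXiv:2308.07915 chunk p0009 L23, L53–54)] -/
theorem allOnes_vecMul_HZ (hA : Odd (hammingNorm C.A)) (hB : Odd (hammingNorm C.B)) :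
    (fun _ => (1 : ZMod 2)) ᵥ* C.HZ = fun _ => 1 :=
  AbelianTwoBlock.allOnes_vecMul_HZ (by rwa [hammingNorm_coeffVec]) (by rwa [hammingNorm_coeffVec])

/-- `𝟙 ∈ rs H^X` for `QC(A, B)` with odd `|A|`, `|B|`. [cite: BravyiEtAl2024, §4 (arXiv:2308.07915 chunk p0009 L23, L53–54)] -/
theorem allOnes_mem_rowSpace_HX (hA : Odd (hammingNorm C.A)) (hB : Odd (hammingNorm C.B)) :
    (fun _ => (1 : ZMod 2)) ∈ rowSpace C.HX :=
  mem_rowSpace_of_vecMul_eq _ (C.allOnes_vecMul_HX hA hB)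

/-- `𝟙 ∈ rs H^Z` for `QC(A, B)` with odd `|A|`, `|B|`. [cite: BravyiEtAl2024, §4 (arXiv:2308.07915 chunk p0009 L23, L53–54)] -/
theorem allOnes_mem_rowSpace_HZ (hA : Odd (hammingNorm C.A)) (hB : Odd (hammingNorm C.B)) :
    (fun _ => (1 : ZMod 2)) ∈ rowSpace C.HZ :=
  mem_rowSpace_of_vecMul_eq _ (C.allOnes_vecMul_HZ hA hB)

/-- **EvenWeight lemma for `QC(A, B)`, `Z` side**: for odd `|A|`, `|B|` every `v` with `H^X v = 0` — in
particular every `Z`-logical — has even Hamming weight.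
[cite: MacWilliamsSloane1977, Ch. 1 §8 Problems (32), (34) (chunk p0032 L13, L25)] [cite: BravyiEtAl2024, §4 (arXiv:2308.07915 chunk p0009 L23, L53–54)] -/
theorem even_hammingNorm_of_HX_mulVec_eq_zero (hA : Odd (hammingNorm C.A)) (hB : Odd (hammingNorm C.B))
    {v : Mono ℓ m ⊕ Mono ℓ m → ZMod 2} (hv : C.HX *ᵥ v = 0) : Even (hammingNorm v) :=
  even_hammingNorm_of_mulVec_eq_zero (C.allOnes_mem_rowSpace_HX hA hB) hv

/-- **EvenWeight lemma for `QC(A, B)`, `X` side**: every `v` with `H^Z v = 0` has even weight.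
[cite: MacWilliamsSloane1977, Ch. 1 §8 Problems (32), (34) (chunk p0032 L13, L25)] [cite: BravyiEtAl2024, §4 (arXiv:2308.07915 chunk p0009 L23, L53–54)] -/
theorem even_hammingNorm_of_HZ_mulVec_eq_zero (hA : Odd (hammingNorm C.A)) (hB : Odd (hammingNorm C.B))
    {v : Mono ℓ m ⊕ Mono ℓ m → ZMod 2} (hv : C.HZ *ᵥ v = 0) : Even (hammingNorm v) :=
  even_hammingNorm_of_mulVec_eq_zero (C.allOnes_mem_rowSpace_HZ hA hB) hv

/-- **The distance of `QC(A, B)` is even** for odd `|A|`, `|B|` (`d = d^Z` by Lemma 1; junk value `0`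
when `k = 0` included). [cite: MacWilliamsSloane1977, Ch. 1 §8 Problems (32), (34) (chunk p0032 L13, L25)] [cite: BravyiEtAl2024, §4 and Lemma 1 (arXiv:2308.07915 chunk p0009 L23, L53–54, L74–77)] -/
theorem even_d (hA : Odd (hammingNorm C.A)) (hB : Odd (hammingNorm C.B)) : Even C.d := by
  rw [d_eq_dZ]
  exact C.css.even_dZ_of_allOnes_mem_rowSpX (C.allOnes_mem_rowSpace_HX hA hB)

/-- **Every BB code with the printed weight-3 side condition has even distance.**
[cite: BravyiEtAl2024, §4 and Lemma 1 (arXiv:2308.07915 chunk p0009 L20–23, L53–54, L74–77)] [cite: MacWilliamsSloane1977, Ch. 1 §8 Problems (32), (34) (chunk p0032 L13, L25)] -/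
theorem even_d_of_isBBPoly (hA : IsBBPoly C.A) (hB : IsBBPoly C.B) : Even C.d :=
  C.even_d (odd_hammingNorm_of_isBBPoly hA) (odd_hammingNorm_of_isBBPoly hB)

/-- **Lift for `QC(A, B)`**: odd `|A|`, `|B|`, `d` even and `d − 1 ≤ d^Z` give `d ≤ d^Z` (kernels may use
`wmax = d − 2`). [cite: MacWilliamsSloane1977, Ch. 1 §8 Problems (32), (34), §9 (I) (chunk p0032 L13, L25; p0033 L16)] [cite: BravyiEtAl2024, §4 (arXiv:2308.07915 chunk p0009 L23, L53–54)] -/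
theorem le_dZ_of_even (hA : Odd (hammingNorm C.A)) (hB : Odd (hammingNorm C.B)) {d : ℕ} (hd : Even d)
    (h : d - 1 ≤ C.css.dZ) : d ≤ C.css.dZ :=
  C.css.le_dZ_of_even (C.allOnes_mem_rowSpace_HX hA hB) hd h

/-- **Certificate lemma with parity for `QC(A, B)`**: odd `|A|`, `|B|`, an explicit `Z`-logical of weight
`d`, and "every `Z`-logical has weight `≥ d − 1`" give `C.d = d`.
[cite: BravyiEtAl2024, Lemma 1 and §4 (arXiv:2308.07915 chunk p0009 L23, L74–77)] [cite: MacWilliamsSloane1977, Ch. 1 §8 Problems (32), (34) (chunk p0032 L13, L25)] -/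
theorem d_eq_of_witness_of_odd (hA : Odd (hammingNorm C.A)) (hB : Odd (hammingNorm C.B)) {d : ℕ}
    {v : Mono ℓ m ⊕ Mono ℓ m → ZMod 2} (hv : C.HX *ᵥ v = 0) (hv' : v ∉ rowSpace C.HZ)
    (hwt : hammingNorm v = d)
    (h : ∀ w : Mono ℓ m ⊕ Mono ℓ m → ZMod 2, C.HX *ᵥ w = 0 → w ∉ rowSpace C.HZ → d - 1 ≤ hammingNorm w) :
    C.d = d := by
  rw [d_eq_dZ]
  exact C.css.dZ_eq_of_witness_of_even (C.allOnes_mem_rowSpace_HX hA hB) hv hv' hwt h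

/-- **Translation pin + parity** (the `[[288,12,18]]`-style certificate): odd `|A|`, `|B|`; an explicit
`Z`-logical `v` of weight `d`; and NO pinned `Z`-logical (`w (L,0) ≠ 0`, or `w|_L = 0 ∧ w (R,0) ≠ 0`) of
weight `≤ d − 2` — give `C.d = d`: parity excludes weight `d − 1`, the translation orbit lemma
(`BB.Code.le_dZ_of_pinned`) reduces to pinned logicals.
[cite: BravyiEtAl2024, Lemma 1, §4 and SI §9.2 (arXiv:2308.07915 chunk p0009 L23, L74–77; p0021 L60 – p0022 L12)] [cite: MacWilliamsSloane1977, Ch. 1 §8 Problems (32), (34) (chunk p0032 L13, L25)] -/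
theorem d_eq_of_witness_of_not_exists_pinned_of_odd (hA : Odd (hammingNorm C.A))
    (hB : Odd (hammingNorm C.B)) {d : ℕ} {v : Mono ℓ m ⊕ Mono ℓ m → ZMod 2} (hv : C.HX *ᵥ v = 0)
    (hv' : v ∉ rowSpace C.HZ) (hwt : hammingNorm v = d)
    (h : ¬ ∃ w : Mono ℓ m ⊕ Mono ℓ m → ZMod 2, C.HX *ᵥ w = 0 ∧ w ∉ rowSpace C.HZ ∧
      hammingNorm w ≤ d - 2 ∧ (w (Sum.inl 0) ≠ 0 ∨ ((∀ x, w (Sum.inl x) = 0) ∧ w (Sum.inr 0) ≠ 0))) :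
    C.d = d := by
  rw [d_eq_dZ]
  refine le_antisymm (hwt ▸ C.css.dZ_le_hammingNorm hv hv') ?_
  refine C.le_dZ_of_even hA hB (hwt ▸ C.even_hammingNorm_of_HX_mulVec_eq_zero hA hB hv) ?_
  refine C.le_dZ_of_pinned ⟨v, hv, hv'⟩ fun w hw hw' hpin => ?_
  by_contra hlt
  exact h ⟨w, hw, hw', by omega, hpin⟩

/-- **Flat-index form** (for checkers on `Fin (ℓm+ℓm)`-indexed bitmask rows; cf.
`BB.Code.d_eq_of_pinned_witness_flat`): odd `|A|`, `|B|`; a flat `Z`-logical `u` (`HXFlat u = 0`,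
`u ∉ rs HZFlat`) of weight `d`; and "every flat `Z`-logical with bit `0` set, or with the left block
(bits `< ℓm`) clear and bit `ℓm` set, has weight `≥ d − 1`" give `C.d = d`.
[cite: BravyiEtAl2024, Lemma 1, §4 and SI §9.2 (arXiv:2308.07915 chunk p0009 L23, L74–77; p0021 L60 – p0022 L12)] [cite: MacWilliamsSloane1977, Ch. 1 §8 Problems (32), (34) (chunk p0032 L13, L25)] -/
theorem d_eq_of_pinned_witness_flat_of_odd (hA : Odd (hammingNorm C.A)) (hB : Odd (hammingNorm C.B))
    {d : ℕ} {u : Fin (ℓ * m + ℓ * m) → ZMod 2}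
    (hu : C.HXFlat *ᵥ u = 0) (hu' : u ∉ rowSpace C.HZFlat) (hwt : hammingNorm u = d)
    (h : ∀ w : Fin (ℓ * m + ℓ * m) → ZMod 2, C.HXFlat *ᵥ w = 0 → w ∉ rowSpace C.HZFlat →
      (w (qubitIndex (Sum.inl 0)) ≠ 0 ∨
        ((∀ i : Fin (ℓ * m + ℓ * m), (i : ℕ) < ℓ * m → w i = 0) ∧ w (qubitIndex (Sum.inr 0)) ≠ 0)) →
      d - 1 ≤ hammingNorm w) :
    C.d = d := by
  have hv : C.HX *ᵥ (u ∘ qubitIndex) = 0 := (C.HXFlat_mulVec_eq_zero_iff u).1 hu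
  have hv' : u ∘ qubitIndex ∉ rowSpace C.HZ := fun h' => hu' ((C.mem_rowSpace_HZFlat_iff u).2 h')
  have hwt' : hammingNorm (u ∘ qubitIndex) = d := by rw [BB.hammingNorm_comp_equiv u qubitIndex, hwt]
  rw [d_eq_dZ]
  refine le_antisymm (hwt' ▸ C.css.dZ_le_hammingNorm hv hv') ?_
  refine C.le_dZ_of_even hA hB (hwt' ▸ C.even_hammingNorm_of_HX_mulVec_eq_zero hA hB hv) ?_
  refine C.le_dZ_of_pinned ⟨_, hv, hv'⟩ fun w hw hw' hpin => ?_
  have hcomp : (w ∘ qubitIndex.symm) ∘ (qubitIndex (ℓ := ℓ) (m := m)) = w := by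
    funext q; simp
  have h1 : C.HXFlat *ᵥ (w ∘ qubitIndex.symm) = 0 :=
    (C.HXFlat_mulVec_eq_zero_iff _).2 (by rw [hcomp]; exact hw)
  have h2 : w ∘ qubitIndex.symm ∉ rowSpace C.HZFlat := fun h' => by
    have h'' := (C.mem_rowSpace_HZFlat_iff _).1 h'
    rw [hcomp] at h''
    exact hw' h''
  have h3 := h _ h1 h2 (by rw [← forall_inl_eq_zero_iff]; simpa using hpin)
  rwa [hammingNorm_comp_equiv w qubitIndex.symm] at h3

/-- With the printed side condition: `IsBBPoly A`, `IsBBPoly B` discharge the oddness hypotheses of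
`d_eq_of_witness_of_not_exists_pinned_of_odd`. [cite: BravyiEtAl2024, §4, Lemma 1 and SI §9.2 (arXiv:2308.07915 chunk p0009 L20–23, L74–77; p0021 L60 – p0022 L12)] -/
theorem d_eq_of_witness_of_not_exists_pinned_of_isBBPoly (hA : IsBBPoly C.A) (hB : IsBBPoly C.B)
    {d : ℕ} {v : Mono ℓ m ⊕ Mono ℓ m → ZMod 2} (hv : C.HX *ᵥ v = 0) (hv' : v ∉ rowSpace C.HZ)
    (hwt : hammingNorm v = d)
    (h : ¬ ∃ w : Mono ℓ m ⊕ Mono ℓ m → ZMod 2, C.HX *ᵥ w = 0 ∧ w ∉ rowSpace C.HZ ∧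
      hammingNorm w ≤ d - 2 ∧ (w (Sum.inl 0) ≠ 0 ∨ ((∀ x, w (Sum.inl x) = 0) ∧ w (Sum.inr 0) ≠ 0))) :
    C.d = d :=
  C.d_eq_of_witness_of_not_exists_pinned_of_odd (odd_hammingNorm_of_isBBPoly hA)
    (odd_hammingNorm_of_isBBPoly hB) hv hv' hwt h

end Code

/-- The five printed instances have even distance (whatever its value): `[[72,12,6]]`, `[[90,8,10]]`,
`[[108,8,10]]`, `[[144,12,12]]`, `[[288,12,18]]`.
[cite: BravyiEtAl2024, §4 and Table 3 / Nature Table 1 (arXiv:2308.07915 chunk p0009 L20–23, L53–54)] [cite: MacWilliamsSloane1977, Ch. 1 §8 Problems (32), (34) (chunk p0032 L13, L25)] -/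
theorem even_d_instances :
    Even bb72.d ∧ Even bb90.d ∧ Even bb108.d ∧ Even bb144.d ∧ Even bb288.d :=
  ⟨bb72.even_d_of_isBBPoly isBBPoly_bb72.1 isBBPoly_bb72.2,
    bb90.even_d_of_isBBPoly isBBPoly_bb90.1 isBBPoly_bb90.2,
    bb108.even_d_of_isBBPoly isBBPoly_bb108.1 isBBPoly_bb108.2,
    bb144.even_d_of_isBBPoly isBBPoly_bb144.1 isBBPoly_bb144.2,
    bb288.even_d_of_isBBPoly isBBPoly_bb288.1 isBBPoly_bb288.2⟩

end BB

end Literature.InformationTheory.QuantumCodes
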